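import Mathlib
import HarnessLib
import Summits.Ventures.LatticeQCDFlow.Scoring.PairAcceptanceVariance
import Summits.Ventures.LatticeQCDFlow.Scoring.IIDKernelMoments

/-!
# LatticeQCDFlow / Scoring — Hoeffding's variance decomposition for an order-2 U-statistic of
# `n` independent, identically distributed draws on a GENERAL measurable space:
# `Var U = (2ζ₂ + 4(n − 2)ζ₁)/(n(n − 1))`

HONEST FRAMING: exact (Metropolis-corrected) sampling algorithms for lattice gauge theory;
figures of merit are autocorrelation/cost numbers at stated couplings and volumes; no
continuum-physics claim.

Venture `LatticeQCDFlow` (cell pub-lqcd), sub-topic `Scoring`; FANOUT row 3 (`s0-u1-a`, S0-B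
implementation A, GEN-10).  The MEASURE-THEORETIC form of row 3's `Scoring/UStatisticVariance`
(GEN-8: finite configuration space, finite sums) — our formalisation of a PUBLISHED identity,
Hoeffding (1948, Ann. Math. Statist. 19, 293–325, §5, the variance of a U-statistic, order `m = 2`;
Serfling 1980 §5.2.1 Lemma A), NAMED ONLY as the printed counterpart; NO definition is introduced.
The setting is the one of row 4's `Scoring/AllPairsAcceptance` and of the tree's
`Literature.Probability.Moments.UStatisticHoeffding`: an abstract probability space `(Ω, P)`,
draws `x i : Ω → X` (`i : Fin n`) into ANY measurable space, mutually independent (`iIndepFun`)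
with a common law `ν` (`P ∘ (x i)⁻¹ = ν`), and a symmetric kernel `F` that is merely
SQUARE-INTEGRABLE under `ν ⊗ ν` (no boundedness, no weight ceiling) — so it covers the flow
sampler's pair statistics on continuous field spaces (the acceptance kernel `min(w, w′)`, the Gini
kernel `|w − w′|`, `(w − w′)²`), where row 3's finite files do not apply.  The partner-pair
moments (`μ_F`, `c₂`, `c₁`, `μ_F²` along coincident / index-sharing / disjoint partner pairs) are
row 3's `Scoring/IIDKernelMoments` (imported); the count `card_offDiag_sdiff_pair` is row 3's
`Scoring/PairAcceptanceVariance` (imported).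

## Setting

`μ_F = ∫ F d(ν⊗ν)` (`= E U`), `h(a) = ∫ F(a, b) dν(b)` (Hoeffding's projection),
`c₁ = ∫ h² dν`, `c₂ = ∫ F² d(ν⊗ν)`, `ζ₁ = c₁ − μ_F²`, `ζ₂ = c₂ − μ_F²`;
`U(ω) = Σ_{(i,j) ∈ offDiag} F(x_i ω, x_j ω) / (n(n−1))`.

* `integral_sum_offDiag_kernel_iid` — `E[Σ_{offDiag} F(x_i, x_j)] = n(n−1)·μ_F`;
* **`variance_ustat₂_eq_iid`** — for `n ≥ 2`:
  `E[(U − μ_F)²] = (2(c₂ − μ_F²) + 4(n − 2)(c₁ − μ_F²)) / (n(n − 1))`, by the same count as the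
  finite file: of the `n(n−1)` ordered partner pairs of an ordered pair, `(n−2)(n−3)` are disjoint
  from it, `2` coincide with it as a set, `4(n−2)` share exactly one index;
* `measurable_ustat₂_iid`, `integral_ustat₂_iid` (`E U = μ_F`), the same law in Mathlib's
  `Var[·]` form, **`variance_ustat₂_iid`**, `memLp_ustat₂_iid` (`U ∈ L²(P)`) and the Chebyshev
  bound with the exact variance, `chebyshev_ustat₂_iid`.

NOT CLAIMED: higher-order kernels (`m ≥ 3`); non-identically distributed draws; the projections
`0 ≤ 2ζ₁ ≤ ζ₂` and the sandwich `4ζ₁/n ≤ Var U ≤ 2ζ₂/n` on a general space (a companion file);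
asymptotic normality; nothing about any statistic of ours.
-/

namespace Summit.Ventures.LatticeQCDFlow.Scoring

open MeasureTheory ProbabilityTheory Finset

section IID

variable {Ω : Type*} [MeasurableSpace Ω] {P : Measure Ω} [IsProbabilityMeasure P]
variable {X : Type*} [MeasurableSpace X] {ν : Measure X}
variable {n : ℕ} {x : Fin n → Ω → X}

/-! ### §4 Hoeffding's decomposition -/

/-- **Unbiasedness**: `E[Σ_{(i,j) ∈ offDiag} F(x_i, x_j)] = #offDiag · ∫ F d(ν ⊗ ν)`. [folklore] -/
theorem integral_sum_offDiag_kernel_iid (hxm : ∀ i, Measurable (x i)) (hind : iIndepFun x P)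
    (hlaw : ∀ i, Measure.map (x i) P = ν) {F : X → X → ℝ}
    (hFm : Measurable fun z : X × X => F z.1 z.2)
    (hF2 : MemLp (fun z : X × X => F z.1 z.2) 2 (ν.prod ν)) :
    ∫ ω, ∑ z ∈ (univ : Finset (Fin n)).offDiag, F (x z.1 ω) (x z.2 ω) ∂P
      = ((univ : Finset (Fin n)).offDiag.card : ℝ) * ∫ z, F z.1 z.2 ∂(ν.prod ν) := by
  rw [integral_finsetSum _ fun z hz =>
      integrable_kernel_iid hxm hind hlaw hF2 (mem_offDiag.mp hz).2.2,
    sum_congr rfl fun z hz => integral_kernel_iid hxm hind hlaw hFm (mem_offDiag.mp hz).2.2,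
    sum_const, nsmul_eq_mul]

/-- **Hoeffding's variance decomposition, order 2, on a general measurable space.**  For `n ≥ 2`
independent draws `x_i` with common law `ν` and a symmetric kernel `F ∈ L²(ν ⊗ ν)`:
`E[(U − μ_F)²] = (2(c₂ − μ_F²) + 4(n − 2)(c₁ − μ_F²)) / (n(n − 1))` where
`U = Σ_{offDiag} F(x_i, x_j)/(n(n−1))`, `μ_F = ∫ F d(ν⊗ν)`, `c₂ = ∫ F² d(ν⊗ν)`,
`c₁ = ∫ (∫ F(a,b) dν(b))² dν(a)`.  (Hoeffding 1948: `Var U = (4(n−2)ζ₁ + 2ζ₂)/(n(n−1))`,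
`ζ₁ = c₁ − μ_F²`, `ζ₂ = c₂ − μ_F²`.) [folklore] -/
theorem variance_ustat₂_eq_iid (hxm : ∀ i, Measurable (x i)) (hind : iIndepFun x P)
    (hlaw : ∀ i, Measure.map (x i) P = ν) {F : X → X → ℝ}
    (hFm : Measurable fun z : X × X => F z.1 z.2) (hF : ∀ a b, F a b = F b a)
    (hF2 : MemLp (fun z : X × X => F z.1 z.2) 2 (ν.prod ν)) (hn : 2 ≤ n) :
    ∫ ω, ((∑ z ∈ (univ : Finset (Fin n)).offDiag, F (x z.1 ω) (x z.2 ω)) / (n * (n - 1))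
        - ∫ z, F z.1 z.2 ∂(ν.prod ν)) ^ 2 ∂P
      = (2 * ((∫ z, F z.1 z.2 ^ 2 ∂(ν.prod ν)) - (∫ z, F z.1 z.2 ∂(ν.prod ν)) ^ 2)
          + 4 * (n - 2) * ((∫ a, (∫ b, F a b ∂ν) ^ 2 ∂ν) - (∫ z, F z.1 z.2 ∂(ν.prod ν)) ^ 2))
        / (n * (n - 1)) := by
  classical
  set O : Finset (Fin n × Fin n) := (univ : Finset (Fin n)).offDiag with hOdef
  set h : (Fin n × Fin n) → Ω → ℝ := fun z ω => F (x z.1 ω) (x z.2 ω) with hhdef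
  set a := ∫ z, F z.1 z.2 ∂(ν.prod ν) with hadef
  set c₂ := ∫ z, F z.1 z.2 ^ 2 ∂(ν.prod ν) with hc₂def
  set c₁ := ∫ a, (∫ b, F a b ∂ν) ^ 2 ∂ν with hc₁def
  have h2 : (2 : ℝ) ≤ n := by exact_mod_cast hn
  have hNpos : (0 : ℝ) < n * (n - 1) := by
    have : (0 : ℝ) < n := by linarith
    have : (0 : ℝ) < n - 1 := by linarith
    positivity
  have hOcard : (O.card : ℝ) = n * (n - 1) := by
    rw [hOdef, offDiag_card, card_univ, Fintype.card_fin, Nat.cast_sub (Nat.le_mul_self n)]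
    push_cast; ring
  -- integrability of the kernel terms and of their pairwise products
  have hInt1 : ∀ z ∈ O, Integrable (h z) P := fun z hz =>
    integrable_kernel_iid hxm hind hlaw hF2 (mem_offDiag.mp hz).2.2
  have hInt2 : ∀ z ∈ O, ∀ z' ∈ O, Integrable (fun ω => h z ω * h z' ω) P := fun z hz z' hz' =>
    integrable_kernel_mul_kernel_iid hxm hind hlaw hF2 (mem_offDiag.mp hz).2.2
      (mem_offDiag.mp hz').2.2
  have hexp : ∀ ω, (∑ z ∈ O, h z ω) ^ 2 = ∑ z ∈ O, ∑ z' ∈ O, h z ω * h z' ω := fun ω => by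
    rw [sq, sum_mul_sum]
  have hS1 : Integrable (fun ω => ∑ z ∈ O, h z ω) P := integrable_finsetSum _ hInt1
  have hS2 : Integrable (fun ω => (∑ z ∈ O, h z ω) ^ 2) P := by
    simp_rw [hexp]
    exact integrable_finsetSum _ fun z hz => integrable_finsetSum _ fun z' hz' => hInt2 z hz z' hz'
  -- mean
  have hmean : ∫ ω, ∑ z ∈ O, h z ω ∂P = n * (n - 1) * a := by
    rw [← hOcard]
    exact integral_sum_offDiag_kernel_iid hxm hind hlaw hFm hF2
  -- second moment, exactly
  have hsecond : ∫ ω, (∑ z ∈ O, h z ω) ^ 2 ∂P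
      = n * (n - 1) * ((n - 2) * (n - 3) * a ^ 2 + 2 * c₂ + (4 * n - 8) * c₁) := by
    simp_rw [hexp]
    rw [integral_finsetSum _ fun z hz =>
      integrable_finsetSum _ fun z' hz' => hInt2 z hz z' hz']
    have hz : ∀ z ∈ O, ∫ ω, ∑ z' ∈ O, h z ω * h z' ω ∂P
        = (n - 2) * (n - 3) * a ^ 2 + 2 * c₂ + (4 * n - 8) * c₁ := by
      intro z hzO
      rw [integral_finsetSum _ fun z' hz' => hInt2 z hzO z' hz']
      obtain ⟨-, -, hij⟩ := mem_offDiag.mp hzO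
      set D : Finset (Fin n × Fin n) := ((univ : Finset (Fin n)) \ {z.1, z.2}).offDiag with hDdef
      set C : Finset (Fin n × Fin n) := {z, z.swap} with hCdef
      have hDsub : D ⊆ O := by
        intro z' hz'
        rw [hDdef, mem_offDiag] at hz'
        rw [hOdef, mem_offDiag]
        exact ⟨mem_univ _, mem_univ _, hz'.2.2⟩
      have hzs : z ≠ z.swap := fun e => hij (congrArg Prod.fst e)
      have hCsub : C ⊆ O \ D := by
        intro z' hz'
        rw [hCdef, mem_insert, mem_singleton] at hz'
        rw [mem_sdiff, hOdef, mem_offDiag, hDdef, mem_offDiag, mem_sdiff, mem_insert]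
        rcases hz' with rfl | rfl
        · exact ⟨⟨mem_univ _, mem_univ _, hij⟩, fun hD => hD.1.2 (Or.inl rfl)⟩
        · refine ⟨⟨mem_univ _, mem_univ _, fun e => hij e.symm⟩, fun hD => hD.1.2 ?_⟩
          rw [mem_singleton]
          exact Or.inr rfl
      obtain ⟨hDcard, hRcard⟩ := card_offDiag_sdiff_pair hij
      have hCcard : C.card = 2 := by rw [hCdef]; exact card_pair hzs
      have hRcard' : (((O \ D) \ C).card : ℝ) = 4 * n - 8 := by
        rw [card_sdiff_of_subset hCsub, Nat.cast_sub (card_le_card hCsub), hCcard, hOdef, hDdef,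
          hRcard]
        push_cast; ring
      rw [← sum_sdiff hDsub, ← sum_sdiff hCsub]
      -- disjoint partners: exactly `μ_F²` each
      have hDsum : ∑ z' ∈ D, ∫ ω, h z ω * h z' ω ∂P = (n - 2) * (n - 3) * a ^ 2 := by
        have hterm : ∀ z' ∈ D, ∫ ω, h z ω * h z' ω ∂P = a ^ 2 := by
          intro z' hz'
          rw [hDdef, mem_offDiag, mem_sdiff, mem_sdiff, mem_insert, mem_singleton, mem_insert,
            mem_singleton] at hz'
          obtain ⟨⟨-, hk⟩, ⟨-, hl⟩, hkl⟩ := hz'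
          obtain ⟨hk1, hk2⟩ := not_or.mp hk
          obtain ⟨hl1, hl2⟩ := not_or.mp hl
          exact integral_kernel_mul_kernel_disjoint_iid hxm hind hlaw hFm hF2 hij hkl (Ne.symm hk1)
            (Ne.symm hl1) (Ne.symm hk2) (Ne.symm hl2)
        rw [sum_congr rfl hterm, sum_const, nsmul_eq_mul, hDdef, hDcard]
      -- the two coincident partners `z`, `z.swap`: exactly `c₂` each
      have hCsum : ∑ z' ∈ C, ∫ ω, h z ω * h z' ω ∂P = 2 * c₂ := by
        rw [hCdef, sum_pair hzs]
        have e1 : ∫ ω, h z ω * h z ω ∂P = c₂ :=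
          integral_kernel_mul_self_iid hxm hind hlaw hFm hij
        have e2 : ∫ ω, h z ω * h z.swap ω ∂P = c₂ :=
          integral_kernel_mul_swap_iid hxm hind hlaw hFm hF hij
        rw [e1, e2]
        ring
      -- the `4(n − 2)` partners sharing exactly one index: exactly `c₁` each
      have hRsum : ∑ z' ∈ (O \ D) \ C, ∫ ω, h z ω * h z' ω ∂P = (4 * n - 8) * c₁ := by
        have hterm : ∀ z' ∈ (O \ D) \ C, ∫ ω, h z ω * h z' ω ∂P = c₁ := by
          intro z' hz'
          obtain ⟨hOD, hC⟩ := mem_sdiff.mp hz'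
          obtain ⟨hO', hD'⟩ := mem_sdiff.mp hOD
          have hkl : z'.1 ≠ z'.2 := by
            rw [hOdef, mem_offDiag] at hO'
            exact hO'.2.2
          have hshare : z'.1 = z.1 ∨ z'.1 = z.2 ∨ z'.2 = z.1 ∨ z'.2 = z.2 := by
            by_contra hcon
            push Not at hcon
            obtain ⟨h1, h2, h3, h4⟩ := hcon
            apply hD'
            rw [hDdef, mem_offDiag, mem_sdiff, mem_sdiff, mem_insert, mem_singleton, mem_insert,
              mem_singleton]
            exact ⟨⟨mem_univ _, not_or.mpr ⟨h1, h2⟩⟩, ⟨mem_univ _, not_or.mpr ⟨h3, h4⟩⟩, hkl⟩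
          have hC' : z' ≠ z ∧ z' ≠ z.swap := by
            rw [hCdef, mem_insert, mem_singleton] at hC
            exact not_or.mp hC
          have hne : ¬(z'.1 = z.1 ∧ z'.2 = z.2) := fun e => hC'.1 (Prod.ext e.1 e.2)
          have hne' : ¬(z'.1 = z.2 ∧ z'.2 = z.1) := fun e => hC'.2 (Prod.ext e.1 e.2)
          exact integral_kernel_mul_kernel_of_shared_iid hxm hind hlaw hFm hF hF2 hij hkl hshare
            hne hne'
        rw [sum_congr rfl hterm, sum_const, nsmul_eq_mul, hRcard']
      rw [hDsum, hCsum, hRsum]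
      ring
    rw [sum_congr rfl hz, sum_const, nsmul_eq_mul, hOcard]
  -- assemble: `E[(S/N − a)²] = (E[S²] − 2·N·a·E[S] + (N a)²)/N²`
  have hn0 : (n : ℝ) ≠ 0 := by positivity
  have hn1 : (n : ℝ) - 1 ≠ 0 := (by linarith : (0 : ℝ) < n - 1).ne'
  have hsq : ∀ ω, ((∑ z ∈ O, h z ω) / (n * (n - 1)) - a) ^ 2
      = ((∑ z ∈ O, h z ω) ^ 2 - 2 * (n * (n - 1) * a) * (∑ z ∈ O, h z ω)
          + (n * (n - 1) * a) ^ 2) / (n * (n - 1)) ^ 2 := by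
    intro ω
    field_simp
    ring
  have hI3 : Integrable (fun ω => (∑ z ∈ O, h z ω) ^ 2
      - 2 * (n * (n - 1) * a) * (∑ z ∈ O, h z ω)) P := hS2.sub (hS1.const_mul _)
  show ∫ ω, ((∑ z ∈ O, h z ω) / (n * (n - 1)) - a) ^ 2 ∂P
      = (2 * (c₂ - a ^ 2) + 4 * (n - 2) * (c₁ - a ^ 2)) / (n * (n - 1))
  simp_rw [hsq]
  rw [integral_div, integral_add hI3 (integrable_const _), integral_sub hS2 (hS1.const_mul _),
    integral_const_mul, integral_const, smul_eq_mul, probReal_univ, one_mul, hsecond, hmean]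
  field_simp
  ring

/-- The U-statistic `ω ↦ Σ_{offDiag} F(x_i ω, x_j ω)/(n(n−1))` is measurable. [folklore] -/
theorem measurable_ustat₂_iid (hxm : ∀ i, Measurable (x i)) {F : X → X → ℝ}
    (hFm : Measurable fun z : X × X => F z.1 z.2) :
    Measurable fun ω =>
      (∑ z ∈ (univ : Finset (Fin n)).offDiag, F (x z.1 ω) (x z.2 ω)) / (n * (n - 1) : ℝ) :=
  (Finset.measurable_sum _ fun (z : Fin n × Fin n) _ =>
    hFm.comp ((hxm z.1).prodMk (hxm z.2))).div_const _

/-- **`E U = μ_F`**: the U-statistic is unbiased for `∫ F d(ν ⊗ ν)` (`n ≥ 2`). [folklore] -/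
theorem integral_ustat₂_iid (hxm : ∀ i, Measurable (x i)) (hind : iIndepFun x P)
    (hlaw : ∀ i, Measure.map (x i) P = ν) {F : X → X → ℝ}
    (hFm : Measurable fun z : X × X => F z.1 z.2)
    (hF2 : MemLp (fun z : X × X => F z.1 z.2) 2 (ν.prod ν)) (hn : 2 ≤ n) :
    ∫ ω, (∑ z ∈ (univ : Finset (Fin n)).offDiag, F (x z.1 ω) (x z.2 ω)) / (n * (n - 1)) ∂P
      = ∫ z, F z.1 z.2 ∂(ν.prod ν) := by
  have h2 : (2 : ℝ) ≤ n := by exact_mod_cast hn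
  have hNpos : (0 : ℝ) < n * (n - 1) := by
    have : (0 : ℝ) < n := by linarith
    have : (0 : ℝ) < n - 1 := by linarith
    positivity
  have hOcard : (((univ : Finset (Fin n)).offDiag.card : ℕ) : ℝ) = n * (n - 1) := by
    rw [offDiag_card, card_univ, Fintype.card_fin, Nat.cast_sub (Nat.le_mul_self n)]
    push_cast; ring
  rw [integral_div, integral_sum_offDiag_kernel_iid hxm hind hlaw hFm hF2, hOcard,
    mul_div_cancel_left₀ _ hNpos.ne']

/-- **Hoeffding's variance decomposition in Mathlib's `Var[·]` form**: for `n ≥ 2` independent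
draws with common law `ν` and a symmetric kernel `F ∈ L²(ν ⊗ ν)`,
`Var[U] = (2(c₂ − μ_F²) + 4(n − 2)(c₁ − μ_F²)) / (n(n − 1))`. [folklore] -/
theorem variance_ustat₂_iid (hxm : ∀ i, Measurable (x i)) (hind : iIndepFun x P)
    (hlaw : ∀ i, Measure.map (x i) P = ν) {F : X → X → ℝ}
    (hFm : Measurable fun z : X × X => F z.1 z.2) (hF : ∀ a b, F a b = F b a)
    (hF2 : MemLp (fun z : X × X => F z.1 z.2) 2 (ν.prod ν)) (hn : 2 ≤ n) :
    Var[fun ω => (∑ z ∈ (univ : Finset (Fin n)).offDiag, F (x z.1 ω) (x z.2 ω))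
        / (n * (n - 1) : ℝ); P]
      = (2 * ((∫ z, F z.1 z.2 ^ 2 ∂(ν.prod ν)) - (∫ z, F z.1 z.2 ∂(ν.prod ν)) ^ 2)
          + 4 * (n - 2) * ((∫ a, (∫ b, F a b ∂ν) ^ 2 ∂ν) - (∫ z, F z.1 z.2 ∂(ν.prod ν)) ^ 2))
        / (n * (n - 1)) := by
  rw [variance_eq_integral (measurable_ustat₂_iid hxm hFm).aemeasurable]
  change ∫ ω, ((∑ z ∈ (univ : Finset (Fin n)).offDiag, F (x z.1 ω) (x z.2 ω)) / (n * (n - 1))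
      - ∫ ω, (∑ z ∈ (univ : Finset (Fin n)).offDiag, F (x z.1 ω) (x z.2 ω)) / (n * (n - 1)) ∂P)
        ^ 2 ∂P = _
  rw [integral_ustat₂_iid hxm hind hlaw hFm hF2 hn]
  exact variance_ustat₂_eq_iid hxm hind hlaw hFm hF hF2 hn

/-- The U-statistic of a kernel `F ∈ L²(ν ⊗ ν)` is in `L²(P)`. [folklore] -/
theorem memLp_ustat₂_iid (hxm : ∀ i, Measurable (x i)) (hind : iIndepFun x P)
    (hlaw : ∀ i, Measure.map (x i) P = ν) {F : X → X → ℝ}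
    (hF2 : MemLp (fun z : X × X => F z.1 z.2) 2 (ν.prod ν)) :
    MemLp (fun ω =>
      (∑ z ∈ (univ : Finset (Fin n)).offDiag, F (x z.1 ω) (x z.2 ω)) / (n * (n - 1) : ℝ)) 2 P :=
  ((memLp_finsetSum (univ : Finset (Fin n)).offDiag fun z hz =>
      memLp_kernel_iid hxm hind hlaw hF2 (mem_offDiag.mp hz).2.2).mul_const
    ((n * (n - 1) : ℝ))⁻¹).ae_eq (Filter.Eventually.of_forall fun ω => by
      simp only [div_eq_mul_inv])

/-- **Chebyshev with Hoeffding's exact variance**: for `n ≥ 2` and `t > 0`,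
`P(|U − μ_F| ≥ t) ≤ (2(c₂ − μ_F²) + 4(n − 2)(c₁ − μ_F²)) / (n(n − 1)t²)`. [folklore] -/
theorem chebyshev_ustat₂_iid (hxm : ∀ i, Measurable (x i)) (hind : iIndepFun x P)
    (hlaw : ∀ i, Measure.map (x i) P = ν) {F : X → X → ℝ}
    (hFm : Measurable fun z : X × X => F z.1 z.2) (hF : ∀ a b, F a b = F b a)
    (hF2 : MemLp (fun z : X × X => F z.1 z.2) 2 (ν.prod ν)) (hn : 2 ≤ n) {t : ℝ} (ht : 0 < t) :
    P {ω | t ≤ |(∑ z ∈ (univ : Finset (Fin n)).offDiag, F (x z.1 ω) (x z.2 ω)) / (n * (n - 1))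
        - ∫ z, F z.1 z.2 ∂(ν.prod ν)|}
      ≤ ENNReal.ofReal
        ((2 * ((∫ z, F z.1 z.2 ^ 2 ∂(ν.prod ν)) - (∫ z, F z.1 z.2 ∂(ν.prod ν)) ^ 2)
          + 4 * (n - 2) * ((∫ a, (∫ b, F a b ∂ν) ^ 2 ∂ν) - (∫ z, F z.1 z.2 ∂(ν.prod ν)) ^ 2))
        / (n * (n - 1)) / t ^ 2) := by
  have h := meas_ge_le_variance_div_sq (memLp_ustat₂_iid hxm hind hlaw hF2) ht
  rw [variance_ustat₂_iid hxm hind hlaw hFm hF hF2 hn] at h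
  have hm : ∫ ω, (fun ω => (∑ z ∈ (univ : Finset (Fin n)).offDiag, F (x z.1 ω) (x z.2 ω))
      / (n * (n - 1) : ℝ)) ω ∂P = ∫ z, F z.1 z.2 ∂(ν.prod ν) :=
    integral_ustat₂_iid hxm hind hlaw hFm hF2 hn
  rw [hm] at h
  exact h

end IID

end Summit.Ventures.LatticeQCDFlow.Scoring
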